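import Mathlib
import Summits.ValiantsHypothesis.ValiantsHypothesis.Theorems.NewtonUnitEquationsTwoProductsTwoBaseRadixResidue

/-!
# Two-base rigid radix products: `#swVert(∏_i φ_i(x^{N^i}, y^{M^i}) − 1) ≤ k³ q² t`
# (crux `TwoProducts`, line corner-log-linearization, stub `stub_engineTwoBaseRadix`)

The two-base version of the rigid radix rung `Radix.stub_engineRadix` (uniform dilation
`MvPolynomial.expand M : (x, y) ↦ (x^M, y^M)`, file `…TwoProductsRadix.lean`): the `i`-th digit
polynomial is dilated by `(x, y) ↦ (x^{N^i}, y^{M^i})` with two bases `N, M ≥ 1`, i.e. the lattice is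
`Nℕ × Mℕ` and residues are taken mod `N` in the first coordinate and mod `M` in the second.  This
covers the digit grids `N = b²`, `M = b` of Koiran–Portier–Tavenas–Thomassé's Example 3 verbatim.

With the scale vector `s = (N, M) : Fin 2 → ℕ` the `i`-th factor is the dilation
`bind₁ (j ↦ X_j ^ (s ^ i)_j) (φ i)` (`bind₁_eq_dil`); dilations compose (`dil_dil`), so the product
splits as `∏_{i<k+1} φ_i(x^{N^i}, y^{M^i}) = φ_0 · (∏_{i<k} φ_{i+1}(x^{N^i}, y^{M^i}))(x^N, y^M)`
(`prod_dil_succ`), and the residue step `TwoBaseRadixResidue.stub_twoBaseRadixResidueStep` (off the lattice `s • ℕ²`: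
a monomial of the fine factor; on the lattice: Mahler's coefficient identity with the lattice part,
twisted weight) drives the induction `gen` on the number of scales with a general first factor `F`
(`≤ T` monomials in the box `[0, b N) × [0, b M)`): `#swv ≤ T + k (b + k q)² t`; finally
`t + k (q + k q)² t ≤ (k+1)³ q² t`.  No new definitions (south-west vertex sets are written out, as
in `…TwoProductsRadix.lean`, whose `card_le_of_box`, `swv_finite`, `mem_support_sub_one` are reused).
-/

set_option linter.dupNamespace false

namespace Summit.ValiantsHypothesis.ValiantsHypothesis.Theorems.TwoProducts.TwoBaseRadix

open scoped BigOperators Pointwise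
open MvPolynomial TwoBaseRadixResidue

/-! ## Dilations compose; multiscale products -/

/-- Dilations compose: `(p(x^{s'₀}, y^{s'₁}))(x^{s₀}, y^{s₁}) = p(x^{s₀ s'₀}, y^{s₁ s'₁})`. -/
theorem dil_dil (s s' : Fin 2 → ℕ) (p : MvPolynomial (Fin 2) ℂ) :
    bind₁ (fun j => (X j : MvPolynomial (Fin 2) ℂ) ^ s j)
      (bind₁ (fun j => (X j : MvPolynomial (Fin 2) ℂ) ^ s' j) p) =
      bind₁ (fun j => (X j : MvPolynomial (Fin 2) ℂ) ^ (s * s') j) p := by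
  have hfun : (fun i => bind₁ (fun j => (X j : MvPolynomial (Fin 2) ℂ) ^ s j)
      ((X i : MvPolynomial (Fin 2) ℂ) ^ s' i)) = fun j => (X j : MvPolynomial (Fin 2) ℂ) ^ (s * s') j := by
    funext i
    rw [map_pow, bind₁_X_right, ← pow_mul, Pi.mul_apply]
  rw [bind₁_bind₁, hfun]

/-- The trivial dilation is the identity. -/
theorem dil_one (p : MvPolynomial (Fin 2) ℂ) :
    bind₁ (fun j => (X j : MvPolynomial (Fin 2) ℂ) ^ (1 : Fin 2 → ℕ) j) p = p := by
  simp only [Pi.one_apply, pow_one]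
  rw [bind₁_X_left]
  rfl

/-- A multiscale product of polynomials with constant terms `1` has constant term `1`. -/
theorem coeff_zero_prod_dil {k : ℕ} {s : Fin 2 → ℕ} (hs : ∀ j, 1 ≤ s j)
    (φ : Fin k → MvPolynomial (Fin 2) ℂ) (h : ∀ i, coeff 0 (φ i) = 1) :
    coeff 0 (∏ i : Fin k, bind₁ (fun j => (X j : MvPolynomial (Fin 2) ℂ) ^ (s ^ (i : ℕ)) j) (φ i)) = 1 := by
  rw [← constantCoeff_eq, map_prod]
  refine Finset.prod_eq_one ?_
  intro i _
  have hsi : ∀ j, 1 ≤ (s ^ (i : ℕ)) j := fun j => Nat.one_le_pow _ _ (hs j)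
  rw [constantCoeff_eq, coeff_zero_dil hsi, h i]

/-- The Mahler splitting
`∏_{i<k+1} φ_i(x^{s₀^i}, y^{s₁^i}) = φ_0 · (∏_{i<k} φ_{i+1}(x^{s₀^i}, y^{s₁^i}))(x^{s₀}, y^{s₁})`. -/
theorem prod_dil_succ (s : Fin 2 → ℕ) {k : ℕ} (φ : Fin (k + 1) → MvPolynomial (Fin 2) ℂ) :
    ∏ i : Fin (k + 1), bind₁ (fun j => (X j : MvPolynomial (Fin 2) ℂ) ^ (s ^ (i : ℕ)) j) (φ i) =
      φ 0 * bind₁ (fun j => (X j : MvPolynomial (Fin 2) ℂ) ^ s j)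
        (∏ i : Fin k, bind₁ (fun j => (X j : MvPolynomial (Fin 2) ℂ) ^ (s ^ (i : ℕ)) j) (φ i.succ)) := by
  rw [Fin.prod_univ_succ, map_prod]
  congr 1
  · rw [Fin.val_zero, pow_zero, dil_one]
  · refine Finset.prod_congr rfl ?_
    intro i _
    rw [Fin.val_succ, pow_succ', ← dil_dil]

/-- The dilation of the registered statement, `X_j ↦ X_j ^ (N^i, M^i)_j`, is the dilation by
`(N, M) ^ i`. -/
theorem bind₁_eq_dil (N M i : ℕ) :
    bind₁ (fun j : Fin 2 => (X j : MvPolynomial (Fin 2) ℂ) ^ (if j = 0 then N ^ i else M ^ i)) =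
      bind₁ (fun j => (X j : MvPolynomial (Fin 2) ℂ) ^
        ((fun j : Fin 2 => if j = 0 then N else M) ^ i) j) := by
  congr 1
  funext j
  rw [Pi.pow_apply]
  split_ifs <;> rfl

/-- The lattice part lies in the box `[0, b)²` if `supp F ⊆ [0, b s₀) × [0, b s₁)`. -/
theorem latticePart_box {s : Fin 2 → ℕ} {b : ℕ} (hs : ∀ j, 1 ≤ s j) (F : MvPolynomial (Fin 2) ℂ)
    (hF : ∀ e ∈ F.support, e 0 < b * s 0 ∧ e 1 < b * s 1) :
    ∀ d ∈ (∑ d ∈ F.support.image (fun e : Fin 2 →₀ ℕ => Finsupp.equivFunOnFinite.symm (⇑e / s)),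
      (monomial d (coeff (s • d) F) : MvPolynomial (Fin 2) ℂ)).support, d 0 < b ∧ d 1 < b := by
  intro d hd
  rw [mem_support_latticePart hs] at hd
  obtain ⟨h0, h1⟩ := hF _ hd
  rw [pointwise_smul_apply, mul_comm b (s 0)] at h0
  rw [pointwise_smul_apply, mul_comm b (s 1)] at h1
  exact ⟨Nat.lt_of_mul_lt_mul_left h0, Nat.lt_of_mul_lt_mul_left h1⟩

/-- The final arithmetic of the induction step. -/
theorem arith_step (k q t T b : ℕ) :
    T + (b * b * t + k * (b + q + k * q) ^ 2 * t) ≤ T + (k + 1) * (b + (k + 1) * q) ^ 2 * t := by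
  have hsq : b * b ≤ (b + (k + 1) * q) ^ 2 := by
    rw [← pow_two]
    exact Nat.pow_le_pow_left (Nat.le_add_right _ _) 2
  have hsq' : b * b * t ≤ (b + (k + 1) * q) ^ 2 * t := Nat.mul_le_mul_right t hsq
  have heq : b + q + k * q = b + (k + 1) * q := by ring
  have hring : (k + 1) * (b + (k + 1) * q) ^ 2 * t =
      k * (b + (k + 1) * q) ^ 2 * t + (b + (k + 1) * q) ^ 2 * t := by ring
  rw [heq, hring]
  refine Nat.add_le_add_left ?_ T
  rw [Nat.add_comm]
  exact Nat.add_le_add_left hsq' _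

/-! ## The induction on the number of scales -/

/-- Generalised bound: a first factor `F` with `≤ T` monomials in the box `[0, b s₀) × [0, b s₁)`
and constant term `1`, then `k` scales of digit polynomials (`≤ t` monomials, box
`[0, q s₀) × [0, q s₁)`, constant terms `1`):
`#swv(F · (∏_{i<k} φ_i(x^{s₀^i}, y^{s₁^i}))(x^{s₀}, y^{s₁})) ≤ T + k (b + k q)² t`. -/
theorem gen {s : Fin 2 → ℕ} (hs : ∀ j, 1 ≤ s j) : ∀ (k q t T b : ℕ) (F : MvPolynomial (Fin 2) ℂ)
    (φ : Fin k → MvPolynomial (Fin 2) ℂ), coeff 0 F = 1 → F.support.card ≤ T →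
    (∀ e ∈ F.support, e 0 < b * s 0 ∧ e 1 < b * s 1) →
    (∀ i, coeff 0 (φ i) = 1) → (∀ i, (φ i).support.card ≤ t) →
    (∀ i, ∀ e ∈ (φ i).support, e 0 < q * s 0 ∧ e 1 < q * s 1) →
    {e : Fin 2 →₀ ℕ | ∃ w : Fin 2 → ℤ, 0 < w 0 ∧ 0 < w 1 ∧ e ≠ 0 ∧
      e ∈ (F * bind₁ (fun j => (X j : MvPolynomial (Fin 2) ℂ) ^ s j)
        (∏ i : Fin k, bind₁ (fun j => (X j : MvPolynomial (Fin 2) ℂ) ^ (s ^ (i : ℕ)) j) (φ i))).support ∧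
      ∀ e' ∈ (F * bind₁ (fun j => (X j : MvPolynomial (Fin 2) ℂ) ^ s j)
        (∏ i : Fin k, bind₁ (fun j => (X j : MvPolynomial (Fin 2) ℂ) ^ (s ^ (i : ℕ)) j) (φ i))).support,
        e' ≠ 0 → e' ≠ e →
          w 0 * (e 0 : ℤ) + w 1 * (e 1 : ℤ) < w 0 * (e' 0 : ℤ) + w 1 * (e' 1 : ℤ)}.ncard ≤
      T + k * (b + k * q) ^ 2 * t := by
  intro k
  induction k with
  | zero =>
    intro q t T b F φ _ hT _ _ _ _
    simp only [Finset.univ_eq_empty, Finset.prod_empty, map_one, mul_one, zero_mul, add_zero]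
    exact (Set.ncard_le_ncard (Radix.swv_subset_support F)).trans
      ((Set.ncard_coe_finset _).le.trans hT)
  | succ k ih =>
    intro q t T b F φ hF0 hT hFbox hφ0 hφt hφbox
    rw [prod_dil_succ]
    set G' : MvPolynomial (Fin 2) ℂ :=
      ∏ i : Fin k, bind₁ (fun j => (X j : MvPolynomial (Fin 2) ℂ) ^ (s ^ (i : ℕ)) j) (φ i.succ) with hG'
    set G : MvPolynomial (Fin 2) ℂ := φ 0 * bind₁ (fun j => (X j : MvPolynomial (Fin 2) ℂ) ^ s j) G'
      with hGdef
    have hG'0 : coeff 0 G' = 1 := coeff_zero_prod_dil hs _ (fun i => hφ0 i.succ)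
    have hG0 : coeff 0 G = 1 := by
      rw [hGdef, ← constantCoeff_eq, map_mul, constantCoeff_eq, hφ0 0, coeff_zero_dil hs, hG'0,
        mul_one]
    -- the residue step
    have hstep := stub_twoBaseRadixResidueStep s F G hs hG0
    -- the smaller instance
    set F₀ : MvPolynomial (Fin 2) ℂ :=
      ∑ d ∈ F.support.image (fun e : Fin 2 →₀ ℕ => Finsupp.equivFunOnFinite.symm (⇑e / s)),
        (monomial d (coeff (s • d) F) : MvPolynomial (Fin 2) ℂ) with hF₀
    have hF₀0 : coeff 0 F₀ = 1 := by rw [hF₀, coeff_latticePart hs, smul_zero, hF0]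
    have hF₀box : ∀ d ∈ F₀.support, d 0 < b ∧ d 1 < b := latticePart_box hs F hFbox
    have hF₀card : F₀.support.card ≤ b * b := Radix.card_le_of_box _ hF₀box
    set F' : MvPolynomial (Fin 2) ℂ := F₀ * φ 0 with hF'
    have hF'0 : coeff 0 F' = 1 := by
      rw [hF', ← constantCoeff_eq, map_mul, constantCoeff_eq, hF₀0, hφ0 0, mul_one]
    have hF'card : F'.support.card ≤ b * b * t := by
      calc F'.support.card ≤ (F₀.support + (φ 0).support).card :=
            Finset.card_le_card (support_mul _ _)
        _ ≤ F₀.support.card * (φ 0).support.card := Finset.card_add_le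
        _ ≤ b * b * t := Nat.mul_le_mul hF₀card (hφt 0)
    have hF'box : ∀ e ∈ F'.support, e 0 < (b + q) * s 0 ∧ e 1 < (b + q) * s 1 := by
      intro e he
      obtain ⟨d, hd, d', hd', rfl⟩ := Finset.mem_add.1 (support_mul _ _ he)
      obtain ⟨hd0, hd1⟩ := hF₀box d hd
      obtain ⟨hd'0, hd'1⟩ := hφbox 0 d' hd'
      simp only [Finsupp.add_apply]
      have hb0 : b ≤ b * s 0 := Nat.le_mul_of_pos_right _ (hs 0)
      have hb1 : b ≤ b * s 1 := Nat.le_mul_of_pos_right _ (hs 1)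
      rw [add_mul, add_mul]
      constructor
      · linarith
      · linarith
    have hIH := ih q t (b * b * t) (b + q) F' (fun i => φ i.succ) hF'0 hF'card hF'box
      (fun i => hφ0 i.succ) (fun i => hφt i.succ) (fun i => hφbox i.succ)
    have hassoc : F₀ * G = F' * bind₁ (fun j => (X j : MvPolynomial (Fin 2) ℂ) ^ s j) G' := by
      rw [hF', hGdef, mul_assoc]
    rw [hassoc] at hstep
    refine (Set.ncard_le_ncard hstep
      ((Finset.finite_toSet _).union ((Radix.swv_finite _).image _))).trans ?_
    refine (Set.ncard_union_le _ _).trans ?_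
    rw [Set.ncard_coe_finset]
    exact (Nat.add_le_add hT ((Set.ncard_image_le (Radix.swv_finite _)).trans hIH)).trans
      (arith_step k q t T b)

/-! ## The registered rung -/

/-- RUNG — TWO-BASE RIGID RADIX PRODUCTS.  For bases `N, M ≥ 1`, digit polynomials `φ_i`
(`i < k`) with constant terms `1`, at most `t` monomials and exponents `< q N` in `x` and `< q M`
in `y`, the south-west vertices (strict minimisers of a strictly positive integer weight) of
`(∏_i φ_i(x^{N^i}, y^{M^i})) − 1` number at most `k³ q² t`: the two-base multiscale-with-carries
regime of the crux in its one-product / first-order-count form, LINEAR in `t`; it contains the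
digit grids `N = b²`, `M = b` of Koiran–Portier–Tavenas–Thomassé's Example 3.
(Residue decomposition mod `(N, M)`: `TwoBaseRadixResidue.residueOff` + `coeff_smul_mul_dil`,
induction `gen` on the number of scales.) -/
theorem stub_engineTwoBaseRadix : ∀ (k N M q t : ℕ) (φ : Fin k → MvPolynomial (Fin 2) ℂ), 1 ≤ N → 1 ≤ M →
    (∀ i, MvPolynomial.coeff 0 (φ i) = 1) → (∀ i, (φ i).support.card ≤ t) →
    (∀ i, ∀ e ∈ (φ i).support, e 0 < q * N ∧ e 1 < q * M) →
    {e : Fin 2 →₀ ℕ | ∃ w : Fin 2 → ℤ, 0 < w 0 ∧ 0 < w 1 ∧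
        e ∈ ((∏ i : Fin k, MvPolynomial.bind₁ (fun j : Fin 2 => (MvPolynomial.X j : MvPolynomial (Fin 2) ℂ) ^
              (if j = 0 then N ^ (i : ℕ) else M ^ (i : ℕ))) (φ i)) - 1).support ∧
        ∀ e' ∈ ((∏ i : Fin k, MvPolynomial.bind₁ (fun j : Fin 2 => (MvPolynomial.X j : MvPolynomial (Fin 2) ℂ) ^
              (if j = 0 then N ^ (i : ℕ) else M ^ (i : ℕ))) (φ i)) - 1).support, e' ≠ e →
          w 0 * (e 0 : ℤ) + w 1 * (e 1 : ℤ) < w 0 * (e' 0 : ℤ) + w 1 * (e' 1 : ℤ)}.ncard ≤ k ^ 3 * q ^ 2 * t := by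
  intro k N M q t φ hN hM hφ0 hφt hφbox
  -- the scale vector `s = (N, M)`
  set s : Fin 2 → ℕ := fun j => if j = 0 then N else M with hs_def
  have hs0 : s 0 = N := by simp [hs_def]
  have hs1 : s 1 = M := by simp [hs_def]
  have hs : ∀ j, 1 ≤ s j := by
    intro j
    fin_cases j
    · exact hs0 ▸ hN
    · exact hs1 ▸ hM
  have hφbox' : ∀ i, ∀ e ∈ (φ i).support, e 0 < q * s 0 ∧ e 1 < q * s 1 := by
    rw [hs0, hs1]
    exact hφbox
  have hprod : (∏ i : Fin k, MvPolynomial.bind₁ (fun j : Fin 2 =>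
      (MvPolynomial.X j : MvPolynomial (Fin 2) ℂ) ^ (if j = 0 then N ^ (i : ℕ) else M ^ (i : ℕ)))
        (φ i)) = ∏ i : Fin k, bind₁ (fun j => (X j : MvPolynomial (Fin 2) ℂ) ^ (s ^ (i : ℕ)) j) (φ i) :=
    Finset.prod_congr rfl fun i _ => by rw [bind₁_eq_dil]
  rw [hprod]
  set P : MvPolynomial (Fin 2) ℂ :=
    ∏ i : Fin k, bind₁ (fun j => (X j : MvPolynomial (Fin 2) ℂ) ^ (s ^ (i : ℕ)) j) (φ i) with hP
  have hP0 : coeff 0 P = 1 := coeff_zero_prod_dil hs φ hφ0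
  -- the set of the statement is the south-west vertex set of `supp P ∖ 0`
  have hset : {e : Fin 2 →₀ ℕ | ∃ w : Fin 2 → ℤ, 0 < w 0 ∧ 0 < w 1 ∧ e ∈ (P - 1).support ∧
      ∀ e' ∈ (P - 1).support, e' ≠ e →
        w 0 * (e 0 : ℤ) + w 1 * (e 1 : ℤ) < w 0 * (e' 0 : ℤ) + w 1 * (e' 1 : ℤ)} =
      {e : Fin 2 →₀ ℕ | ∃ w : Fin 2 → ℤ, 0 < w 0 ∧ 0 < w 1 ∧ e ≠ 0 ∧ e ∈ P.support ∧
        ∀ e' ∈ P.support, e' ≠ 0 → e' ≠ e →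
          w 0 * (e 0 : ℤ) + w 1 * (e 1 : ℤ) < w 0 * (e' 0 : ℤ) + w 1 * (e' 1 : ℤ)} := by
    ext e
    simp only [Set.mem_setOf_eq, Radix.mem_support_sub_one hP0]
    constructor
    · rintro ⟨w, hw0, hw1, ⟨he0, he⟩, hmin⟩
      exact ⟨w, hw0, hw1, he0, he, fun e' he' he'0 hne => hmin e' ⟨he'0, he'⟩ hne⟩
    · rintro ⟨w, hw0, hw1, he0, he, hmin⟩
      exact ⟨w, hw0, hw1, ⟨he0, he⟩, fun e' he' hne => hmin e' he'.2 he'.1 hne⟩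
  rw [hset]
  cases k with
  | zero =>
    have hP1 : P = 1 := by
      rw [hP]
      simp
    rw [hP1]
    have hempty : {e : Fin 2 →₀ ℕ | ∃ w : Fin 2 → ℤ, 0 < w 0 ∧ 0 < w 1 ∧ e ≠ 0 ∧
        e ∈ (1 : MvPolynomial (Fin 2) ℂ).support ∧
        ∀ e' ∈ (1 : MvPolynomial (Fin 2) ℂ).support, e' ≠ 0 → e' ≠ e →
          w 0 * (e 0 : ℤ) + w 1 * (e 1 : ℤ) < w 0 * (e' 0 : ℤ) + w 1 * (e' 1 : ℤ)} = ∅ := by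
      ext e
      simp only [Set.mem_setOf_eq, Set.mem_empty_iff_false, iff_false, not_exists, not_and]
      intro w _ _ he0 he _
      rw [mem_support_iff, coeff_one, if_neg (Ne.symm he0)] at he
      exact he rfl
    rw [hempty, Set.ncard_empty]
    positivity
  | succ k =>
    -- `q ≥ 1` (the constant term lies in the digit box)
    have hq : 1 ≤ q := by
      have h0mem : (0 : Fin 2 →₀ ℕ) ∈ (φ 0).support := by
        rw [mem_support_iff, hφ0 0]
        exact one_ne_zero
      have := (hφbox 0 0 h0mem).1
      simp only [Finsupp.coe_zero, Pi.zero_apply] at this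
      rcases Nat.eq_zero_or_pos q with hq0 | hq0
      · subst hq0
        simp at this
      · exact hq0
    have hsplit : P = φ 0 * bind₁ (fun j => (X j : MvPolynomial (Fin 2) ℂ) ^ s j)
        (∏ i : Fin k, bind₁ (fun j => (X j : MvPolynomial (Fin 2) ℂ) ^ (s ^ (i : ℕ)) j) (φ i.succ)) := by
      rw [hP, prod_dil_succ]
    have hgen := gen hs k q t t q (φ 0) (fun i => φ i.succ) (hφ0 0) (hφt 0) (hφbox' 0)
      (fun i => hφ0 i.succ) (fun i => hφt i.succ) (fun i => hφbox' i.succ)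
    rw [hsplit]
    refine hgen.trans ?_
    have heq : q + k * q = (k + 1) * q := by ring
    have hring : (k + 1) ^ 3 * q ^ 2 * t =
        k * ((k + 1) * q) ^ 2 * t + (k + 1) ^ 2 * q ^ 2 * t := by ring
    have h1 : t ≤ (k + 1) ^ 2 * q ^ 2 * t :=
      Nat.le_mul_of_pos_left t (Nat.mul_pos (by positivity) (Nat.pow_pos hq))
    rw [heq, hring, Nat.add_comm]
    exact Nat.add_le_add_left h1 _

end Summit.ValiantsHypothesis.ValiantsHypothesis.Theorems.TwoProducts.TwoBaseRadix
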